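import Summits.QuantumFields.YangMills.Theorems.BalabanUVNodesN17AtRecord12
import Literature.MathematicalPhysics.QuantumFieldTheory.Balaban1983to89.Node00.Record12DatumKey

/-!
# BalabanUVNodes ∕ node N17 = NE4 AT THE STAGE-12 KEYS OF RECORD BY NAME — RR-2's canonical datum key `Node00.IsDatumOfRecord₁₂C F N D` with its exposed
# parameter `h.params`, the θ-exposed world-bound key `Node00.IsRateKey₁₂ F N D w θ`, and the LEVEL BUNDLES of RR-1's (stage-free) `Node00.U3Objects₁₁`;
# `S_N17` at the tower-keyed home shape over `Stage12Params` WITH PROVISOS; the keyed U3 glue «(D4) ∧ NE5 ⇒ NE4» at the Stage-12 tuples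

Cell `pub-ymgap`, HUMAN RULING D-0062, seat `pub-ymgap-dag-n17-c` (R134 fan-out, strategy s2), generation 3; companion 15 (§49–§52) of `BalabanUVNodesN17Knit` …
`…N17AtRecord12` (companion 13).  THEOREMS ONLY; imports companion 13 (N17 at `datumOfRecord₁₂` ∕ `IsRecordOfRecord₁₂C`, hence companions 4–12 and module 2's
`N17At ∕ S_N17 ∕ U3Carriers ∕ RateCarriers ∕ RateRecordPred ∕ ReadOutAt ∕ RatesAt`) and RR-2's `Node00/Record12DatumKey` (`IsDatumOfRecord₁₂C` with `.params ∕
.provisos ∕ .admissible ∕ .eq_datumOfRecord₁₂ ∕ .gamma_pos ∕ .βfun_eq_betaOfRecord₁₀`, `IsRateKey₁₂` with `.exists_provisos ∕ .gamma_pos ∕ .gamma_le`; RR-1's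
stage-free containers `U3Objects₁₁` by import); modifies nothing; every cited lemma used BY NAME.  Stage-12 twin of companion 11 (p457345, §37–§40), which is
VACUOUS at Stage 11 (`Node00.not_isRecordOfRecord₁₁C`: the ₁₁ datum key is empty); at Stage 12 the keys have content modulo K0′ (NOT claimed).

THE POINT.  Companion 13 keys every N17 face on an explicit Stage-12 presentation `(θ, hP)`; the rate-record home at ₁₂ is KEYED instead: RR-2's
`IsDatumOfRecord₁₂C F N D := ∃ θ hP, θ.Admissible ∧ D = datumOfRecord₁₂ F N θ hP` with the CANONICAL parameter `h.params` (`Classical.choose`; `h.provisos`,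
`h.admissible`, `h.eq_datumOfRecord₁₂`, `h.βfun_eq_betaOfRecord₁₀ : D.βfun = betaOfRecord₁₀ F N h.params.toStage9Params`), and RR-2's θ-exposed `IsRateKey₁₂ F N D w θ`
(the body of `IsRecordOfRecord₁₂C` at a NAMED θ).  dag-n22-e's (T-RATE) layer B at ₁₂ reads every bundle off `(h.params, h.provisos, g₀, os, k)` —
`RRec₁₂ 𝔯 F D g₀ os R :↔ ∃ (h : IsDatumOfRecord₁₂C F N D) (k : ℕ), R = rateCarriersOfRecord₁₂ 𝔯 F h.params h.provisos g₀ os k` (readings TAKE THE PROVISOS at ₁₂).  So: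
* §49 AT THE DATUM KEY: `N17_iff_betaOfRecord₁₀_params₁₂` (every box side) ∕ `N17_iff_merged_params₁₂` (`γ' ≤ h.params.γ`: ↔ the η-rate of companion 13's assembly line
  `βmT(h.params)`) ∕ `n17At_iff_params₁₂` ∕ `n17At_iff_betaOfRecord₁₀_params₁₂` ∕ `u2Inputs_iff_params₁₂` ∕ `N17_params₁₂_of_split_view` (the split road at the printed
  split of record `oneLoopSplitOfRecord₁₁ (h.params.toStage11 F N p)`, any run `p`) ∕ `af0r_params₁₂_of_N17` (what N17 delivers: (AF-0r) for
  `beta0OfMerged βmT h.params.v₀`).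
* §50 AT THE θ-EXPOSED KEY `IsRateKey₁₂ F N D w θ`: an `iff` about THAT θ — `N17_iff_of_isRateKey₁₂` (the world's window), `N17_iff_of_isRateKey₁₂_of_le`,
  `n17At_iff_of_isRateKey₁₂`, `N17_of_isRateKey₁₂_of_split_view`, `af0r_of_N17_isRateKey₁₂` (no `∃ θ`).
* §51 THE LEVEL BUNDLES `⟨u.levelCarriers k, Window γ, γ, u.κ, u.EA k, u.EB k, u.θ₅, u.C₅, u.moduli, u.C₉, u.ω, u.cr, u.ρ⟩` (companion 11's stage-free
  `n17At_u3Level₁₁_iff`, cited) AT THE ₁₂ KEY: `n17At_u3Level_iff_params₁₂`; the HOME SHAPES over a reading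
  `rc : (F : T4Family) → (θ : Stage12Params F N) → θ.Provisos₁₂ F N → (ℕ → ℝ) → List (ULoop F) → ℕ → RateCarriers N` (layer B's literal shape at ₁₂, `rc` a PARAMETER):
  `s_N17_towerKeyed₁₂_iff` (`S_N17` at «`∃ h k, R = rc F h.params h.provisos g₀ os k`» ⟺ the `betaOfRecord₁₀ h.params.toStage9Params` rate at the reading's letters,
  every datum key ∕ `g₀` ∕ `os` ∕ `k`), `s_N17_towerKeyed₁₂_of_merged`, `s_N17_of_datumKeyed₁₂`, `s_N17_of_rateKeyed₁₂`.
* §52 THE KEYED U3 GLUE at the Stage-12 tuples (readings `rr F θ hP g₀ os`, n27-c XXIV∕XXV's key shape), GUARD-GENERIC in `P F θ hP` (plain `θ.Admissible F N`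
  or LINE №99's unity class `θ.ZtUnity F N ∧ θ.Admissible F N`): `n17_keyed₁₂_of_readOut_keyed` (the `h17` stub from the keyed (D4) and NE5 stubs, pointwise
  `YMDAG.N17.n17At_of_readOutAt`), `ratesAt_keyed₁₂_of_five_glueN17`, `n17_towerKeyed₁₂_of_readOut` (layer B's datum-keyed tower shape).
NOT VACUOUS at Stage 12 modulo K0′; every rate input ((AF-0r), the remainder rate, (D4), NE5, N14∕N15∕N16∕N22 at the tuples) a displayed HYPOTHESIS.

HONEST FRAMING.  Kernel bookkeeping BY NAME; 0 sorry; NE4 NOT IN PRINT ([Balaban1987RG1] (1.20)–(1.22) p. 264) and NOT PROVED; nothing of Bałaban's asserted;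
N17 = composite, NOT discharged; «A: n∕28» unmoved.  One finite four-torus at fixed ε per run — NOT infinite volume, NOT OS on ℝ⁴, NOT a mass gap, NOT Clay.
-/

noncomputable section

open scoped Matrix.Norms.L2Operator

namespace Summit.QuantumFields.YangMills.Theorems.BalabanUVNodesN17

open Literature.MathematicalPhysics.QuantumFieldTheory.Balaban1983to89
open Literature.MathematicalPhysics.QuantumFieldTheory.Balaban1983to89.FlowStep
open Literature.MathematicalPhysics.QuantumFieldTheory.Balaban1983to89.T4CouplingMatching
open Literature.MathematicalPhysics.QuantumFieldTheory.Balaban1983to89.T4Continuum (T4Family FiniteEpsData ULoop)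
open Literature.MathematicalPhysics.QuantumFieldTheory.Balaban1983to89.T4OutputRate (Window)
open Literature.MathematicalPhysics.QuantumFieldTheory.Balaban1983to89.Node00
open Literature.MathematicalPhysics.QuantumFieldTheory.Balaban1983to89.DagBinding (WorldP)
open Summit.QuantumFields.BalabanUV.T4Continuum.Spine.NE4 (NE4OnData U2Inputs ne4OnData_iff)
open YMDAG.UVSplit (Datum U3Carriers RateCarriers RateRecordPred N17At N14At N15At N16At N18At N22At ReadOutAt RatesAt S_N17)

variable {F : T4Family} {N : ℕ} [NeZero N]

/-! ## §49 N17 AT THE CANONICAL DATUM KEY `IsDatumOfRecord₁₂C F N D` (RR-2): the datum's β IS `betaOfRecord₁₀ h.params.toStage9Params` -/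

/-- **N17 AT A STAGE-12 DATUM OF RECORD IS THE SCALE-SHIFT RATE OF `betaOfRecord₁₀ h.params.toStage9Params`** — every box side (`h.βfun_eq_betaOfRecord₁₀`).
[cite: Balaban1987RG1, (1.20)-(1.22) p.264] -/
theorem N17_iff_betaOfRecord₁₀_params₁₂ {D : Datum F N} (h : IsDatumOfRecord₁₂C F N D) (c ρ γ' : ℝ) :
    NE4OnData D c ρ γ' ↔ ScaleShiftRate c ρ γ' (betaOfRecord₁₀ F N h.params.toStage9Params) := by
  rw [ne4OnData_iff, h.βfun_eq_betaOfRecord₁₀]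

/-- **… AND, ON BOXES INSIDE THE CANONICAL RECORD BOX (`γ' ≤ h.params.γ`), OF THE CONTINUOUS-VERSION MERGED β OF `h.params`** — companion 13's assembly line
`βmT(h.params) = betaMerged F (mergedTermFamilyMatT F N (TcOfRecord F N) (chiFixed7 F N h.params.ν) h.params.εbg) h.params.ρ8 h.params.bV` (companion 4
`scaleShiftRate_betaOfMerged_iff`; `betaOfRecord₁₀ = betaOfMerged βmT (beta0OfMerged βmT v₀) γ`, `rfl`). [cite: Balaban1987RG1, (1.22) p.264 and (2.12)-(2.14) p.268] -/
theorem N17_iff_merged_params₁₂ {D : Datum F N} (h : IsDatumOfRecord₁₂C F N D) {c ρ γ' : ℝ} (hγ : γ' ≤ h.params.γ) :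
    NE4OnData D c ρ γ' ↔
      letI := h.params.instVβ₁; letI := h.params.instVβ₂; letI := h.params.instιβ
      ScaleShiftRate c ρ γ'
        (betaMerged F (mergedTermFamilyMatT F N (TcOfRecord F N) (chiFixed7 F N h.params.ν) h.params.εbg) h.params.ρ8 h.params.bV) := by
  letI := h.params.instVβ₁; letI := h.params.instVβ₂; letI := h.params.instιβ
  exact (N17_iff_betaOfRecord₁₀_params₁₂ h c ρ γ').trans
    (scaleShiftRate_betaOfMerged_iff
      (βm := betaMerged F (mergedTermFamilyMatT F N (TcOfRecord F N) (chiFixed7 F N h.params.ν) h.params.εbg) h.params.ρ8 h.params.bV)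
      (β0 := beta0OfMerged (betaMerged F (mergedTermFamilyMatT F N (TcOfRecord F N) (chiFixed7 F N h.params.ν) h.params.εbg) h.params.ρ8 h.params.bV)
        h.params.v₀) hγ)

/-- **… IN CLUSTER K4's LETTERS**: for node U3's carriers `u` with `u.γ ≤ h.params.γ`, `N17At D u ↔` the `βmT(h.params)` rate at `(u.cr·u.C₅·u.θ, u.ρ, u.γ)`.
[cite: Balaban1987RG1, (1.20)-(1.22) p.264] -/
theorem n17At_iff_params₁₂ {D : Datum F N} (h : IsDatumOfRecord₁₂C F N D) (u : U3Carriers) (hγ : u.γ ≤ h.params.γ) :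
    N17At D u ↔
      letI := h.params.instVβ₁; letI := h.params.instVβ₂; letI := h.params.instιβ
      ScaleShiftRate (u.cr * u.C₅ * u.θ) u.ρ u.γ
        (betaMerged F (mergedTermFamilyMatT F N (TcOfRecord F N) (chiFixed7 F N h.params.ν) h.params.εbg) h.params.ρ8 h.params.bV) :=
  N17_iff_merged_params₁₂ h hγ

/-- K4's letters, every box side: `N17At D u ↔ ScaleShiftRate (u.cr·u.C₅·u.θ) u.ρ u.γ (betaOfRecord₁₀ h.params.toStage9Params)`. [cite: Balaban1987RG1, (1.20)-(1.22) p.264] -/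
theorem n17At_iff_betaOfRecord₁₀_params₁₂ {D : Datum F N} (h : IsDatumOfRecord₁₂C F N D) (u : U3Carriers) :
    N17At D u ↔ ScaleShiftRate (u.cr * u.C₅ * u.θ) u.ρ u.γ (betaOfRecord₁₀ F N h.params.toStage9Params) :=
  N17_iff_betaOfRecord₁₀_params₁₂ h _ _ _

/-- **NODE U2's INPUT TRIPLE AT A STAGE-12 DATUM OF RECORD** (box `γ' ≤ h.params.γ`): the `βmT(h.params)` rate ∧ its history moduli ∧ fading memory
(companion 4 `histLipschitz_betaOfMerged_iff` for the moduli). [cite: Balaban1987RG1, §5 p.298] -/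
theorem u2Inputs_iff_params₁₂ {D : Datum F N} (h : IsDatumOfRecord₁₂C F N D) {c C ρ γ' : ℝ} {Λ : ℕ → ℕ → ℝ} (hγ : γ' ≤ h.params.γ) :
    U2Inputs D c C ρ γ' Λ ↔
      letI := h.params.instVβ₁; letI := h.params.instVβ₂; letI := h.params.instιβ
      ScaleShiftRate c ρ γ'
          (betaMerged F (mergedTermFamilyMatT F N (TcOfRecord F N) (chiFixed7 F N h.params.ν) h.params.εbg) h.params.ρ8 h.params.bV) ∧
        HistLipschitz Λ γ'
          (betaMerged F (mergedTermFamilyMatT F N (TcOfRecord F N) (chiFixed7 F N h.params.ν) h.params.εbg) h.params.ρ8 h.params.bV) ∧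
        FadingMemory C ρ Λ := by
  letI := h.params.instVβ₁; letI := h.params.instVβ₂; letI := h.params.instιβ
  unfold U2Inputs
  rw [h.βfun_eq_betaOfRecord₁₀]
  exact and_congr
    (scaleShiftRate_betaOfMerged_iff
      (βm := betaMerged F (mergedTermFamilyMatT F N (TcOfRecord F N) (chiFixed7 F N h.params.ν) h.params.εbg) h.params.ρ8 h.params.bV)
      (β0 := beta0OfMerged (betaMerged F (mergedTermFamilyMatT F N (TcOfRecord F N) (chiFixed7 F N h.params.ν) h.params.εbg) h.params.ρ8 h.params.bV)
        h.params.v₀) hγ)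
    (and_congr
      (histLipschitz_betaOfMerged_iff
        (βm := betaMerged F (mergedTermFamilyMatT F N (TcOfRecord F N) (chiFixed7 F N h.params.ν) h.params.εbg) h.params.ρ8 h.params.bV)
        (β0 := beta0OfMerged (betaMerged F (mergedTermFamilyMatT F N (TcOfRecord F N) (chiFixed7 F N h.params.ν) h.params.εbg) h.params.ρ8 h.params.bV)
          h.params.v₀) hγ)
      Iff.rfl)

/-- **THE SPLIT ROAD AT A STAGE-12 DATUM OF RECORD, THROUGH THE PRINTED SPLIT OF RECORD READ AT THE VIEW** (any run `p`; def-B's `oneLoopSplitOfRecord₁₁`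
∕ `beta0OfRecord₁₁` at `h.params.toStage11 F N p` — a `OneLoopSplit` of `D.βfun`, companion 14): (AF-0r) for `beta0OfRecord₁₁ (h.params.toStage11 p)` (N15 ∕ NODE O)
∧ `RemainderShiftRate (oneLoopSplitOfRecord₁₁ (h.params.toStage11 p)) c₁ ρ γ'` (N16 ∕ N18), `0 ≤ ρ ≤ 1`, `0 ≤ c₀` ⟹ `NE4OnData D (2c₀ + c₁) ρ γ'`, every box side.
[cite: Balaban1987RG1, (2.12)-(2.14) p.268] -/
theorem N17_params₁₂_of_split_view {D : Datum F N} (h : IsDatumOfRecord₁₂C F N D) (p : B12.RunParams) {binf c₀ c₁ ρ γ' : ℝ} (hρ0 : 0 ≤ ρ)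
    (hρ1 : ρ ≤ 1) (hc₀ : 0 ≤ c₀) (hconv : ∀ k, |beta0OfRecord₁₁ F N (h.params.toStage11 F N p) k - binf| ≤ c₀ * ρ ^ k)
    (hrem : RemainderShiftRate (oneLoopSplitOfRecord₁₁ F N (h.params.toStage11 F N p)) c₁ ρ γ') : NE4OnData D (2 * c₀ + c₁) ρ γ' :=
  (N17_iff_betaOfRecord₁₀_params₁₂ h _ _ _).mpr
    (scaleShiftRate_of_split (oneLoopSplitOfRecord₁₁ F N (h.params.toStage11 F N p)) hρ0 hρ1 hc₀ hconv hrem)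

/-- **WHAT N17 DELIVERS AT A STAGE-12 DATUM OF RECORD**: on a box side `0 < γ' ≤ h.params.γ` with `ρ < 1`, if `Beta0LimitExists βmT(h.params) h.params.v₀` holds at
COHERENT reference histories with entries in `]0,γ']`, then `NE4OnData D c ρ γ'` gives (AF-0r) `∃ β⁰_∞, |beta0OfMerged βmT(h.params) h.params.v₀ k − β⁰_∞| ≤ (c∕(1−ρ))ρ^k`
(companion 4 `af0r_beta0OfMerged_of_scaleShiftRate`). [cite: Balaban1987RG1, (2.12)-(2.14) p.268] -/
theorem af0r_params₁₂_of_N17 {D : Datum F N} (h : IsDatumOfRecord₁₂C F N D) {c ρ γ' : ℝ} (hγ : γ' ≤ h.params.γ) (hγ' : 0 < γ') (hρ1 : ρ < 1)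
    (hlim : letI := h.params.instVβ₁; letI := h.params.instVβ₂; letI := h.params.instιβ
      Beta0LimitExists (betaMerged F (mergedTermFamilyMatT F N (TcOfRecord F N) (chiFixed7 F N h.params.ν) h.params.εbg) h.params.ρ8 h.params.bV)
        h.params.v₀)
    (hcoh : ∀ k, Fin.tail (h.params.v₀ (k + 1)) = h.params.v₀ k) (hadm : ∀ k i, 0 < h.params.v₀ k i ∧ h.params.v₀ k i ≤ γ')
    (hN17 : NE4OnData D c ρ γ') :
    letI := h.params.instVβ₁; letI := h.params.instVβ₂; letI := h.params.instιβ
    ∃ binf : ℝ, ∀ k,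
      |beta0OfMerged (betaMerged F (mergedTermFamilyMatT F N (TcOfRecord F N) (chiFixed7 F N h.params.ν) h.params.εbg) h.params.ρ8 h.params.bV)
          h.params.v₀ k - binf| ≤ c / (1 - ρ) * ρ ^ k := by
  letI := h.params.instVβ₁; letI := h.params.instVβ₂; letI := h.params.instιβ
  exact af0r_beta0OfMerged_of_scaleShiftRate hlim hcoh hadm hγ' hρ1 ((N17_iff_merged_params₁₂ h hγ).mp hN17)

/-! ## §50 N17 AT THE θ-EXPOSED WORLD-BOUND KEY `IsRateKey₁₂ F N D w θ` (RR-2 §3): an `iff` about THAT θ -/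

/-- **N17 AT A KEYED STAGE-12 RECORD, ON THE WORLD's WINDOW, IS THE SCALE-SHIFT RATE OF THE KEY's MERGED β `βmT(θ)`**: `IsRateKey₁₂ F N D w θ ⊢
NE4OnData D c ρ w.γ ↔ ScaleShiftRate c ρ w.γ βmT(θ)` (the key realises `D = datumOfRecord₁₂ θ hP` with `w.γ ≤ θ.γ`; companion 13 `N17_datumOfRecord₁₂_iff_merged`).
[cite: Balaban1987RG1, (1.20)-(1.22) p.264; Balaban1989LargeFieldII, Thm 1 p.355] -/
theorem N17_iff_of_isRateKey₁₂ {D : Datum F N} {w : WorldP} {θ : Stage12Params F N} (hk : IsRateKey₁₂ F N D w θ) (c ρ : ℝ) :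
    NE4OnData D c ρ w.γ ↔
      letI := θ.instVβ₁; letI := θ.instVβ₂; letI := θ.instιβ
      ScaleShiftRate c ρ w.γ (betaMerged F (mergedTermFamilyMatT F N (TcOfRecord F N) (chiFixed7 F N θ.ν) θ.εbg) θ.ρ8 θ.bV) := by
  obtain ⟨hP, -, hD⟩ := hk.exists_provisos
  have hγ := hk.gamma_le
  subst hD
  exact N17_datumOfRecord₁₂_iff_merged θ hP hγ

/-- … on ANY box inside the key's record box (`γ' ≤ θ.γ`). [cite: Balaban1987RG1, (1.20)-(1.22) p.264] -/
theorem N17_iff_of_isRateKey₁₂_of_le {D : Datum F N} {w : WorldP} {θ : Stage12Params F N} (hk : IsRateKey₁₂ F N D w θ) {c ρ γ' : ℝ}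
    (hγ : γ' ≤ θ.γ) :
    NE4OnData D c ρ γ' ↔
      letI := θ.instVβ₁; letI := θ.instVβ₂; letI := θ.instιβ
      ScaleShiftRate c ρ γ' (betaMerged F (mergedTermFamilyMatT F N (TcOfRecord F N) (chiFixed7 F N θ.ν) θ.εbg) θ.ρ8 θ.bV) := by
  obtain ⟨hP, -, hD⟩ := hk.exists_provisos
  subst hD
  exact N17_datumOfRecord₁₂_iff_merged θ hP hγ

/-- … in K4's letters, for node U3's carriers with `u.γ ≤ θ.γ`. [cite: Balaban1987RG1, (1.20)-(1.22) p.264] -/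
theorem n17At_iff_of_isRateKey₁₂ {D : Datum F N} {w : WorldP} {θ : Stage12Params F N} (hk : IsRateKey₁₂ F N D w θ) (u : U3Carriers)
    (hγ : u.γ ≤ θ.γ) :
    N17At D u ↔
      letI := θ.instVβ₁; letI := θ.instVβ₂; letI := θ.instιβ
      ScaleShiftRate (u.cr * u.C₅ * u.θ) u.ρ u.γ (betaMerged F (mergedTermFamilyMatT F N (TcOfRecord F N) (chiFixed7 F N θ.ν) θ.εbg) θ.ρ8 θ.bV) :=
  N17_iff_of_isRateKey₁₂_of_le hk hγ

/-- **THE SPLIT ROAD AT A KEYED STAGE-12 RECORD** on the world's window, through the printed split of record at the view (any run `p`):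
(AF-0r)(`beta0OfRecord₁₁ (θ.toStage11 p)`) ∧ `RemainderShiftRate (oneLoopSplitOfRecord₁₁ (θ.toStage11 p)) c₁ ρ w.γ`, `0 ≤ ρ ≤ 1`, `0 ≤ c₀` ⟹ `NE4OnData D (2c₀ + c₁) ρ w.γ`.
[cite: Balaban1987RG1, (2.12)-(2.14) p.268] -/
theorem N17_of_isRateKey₁₂_of_split_view {D : Datum F N} {w : WorldP} {θ : Stage12Params F N} (hk : IsRateKey₁₂ F N D w θ) (p : B12.RunParams)
    {binf c₀ c₁ ρ : ℝ} (hρ0 : 0 ≤ ρ) (hρ1 : ρ ≤ 1) (hc₀ : 0 ≤ c₀) (hconv : ∀ k, |beta0OfRecord₁₁ F N (θ.toStage11 F N p) k - binf| ≤ c₀ * ρ ^ k)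
    (hrem : RemainderShiftRate (oneLoopSplitOfRecord₁₁ F N (θ.toStage11 F N p)) c₁ ρ w.γ) : NE4OnData D (2 * c₀ + c₁) ρ w.γ := by
  obtain ⟨hP, -, hD⟩ := hk.exists_provisos
  subst hD
  exact scaleShiftRate_of_split (oneLoopSplitOfRecord₁₁ F N (θ.toStage11 F N p)) hρ0 hρ1 hc₀ hconv hrem

/-- **WHAT N17 DELIVERS AT A KEYED STAGE-12 RECORD — ABOUT THE KEY's OWN θ** (no `∃ θ`, contrast companion 13 `af0r_of_N17_isRecordOfRecord₁₂C`): `NE4OnData D c ρ w.γ`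
with `ρ < 1`, `Beta0LimitExists βmT(θ) θ.v₀` at coherent reference histories with entries in `]0, w.γ]` ⟹ `∃ β⁰_∞, |beta0OfMerged βmT(θ) θ.v₀ k − β⁰_∞| ≤ (c∕(1−ρ))ρ^k`
(`0 < w.γ` is the key's clause). [cite: Balaban1987RG1, (2.12)-(2.14) p.268] -/
theorem af0r_of_N17_isRateKey₁₂ {D : Datum F N} {w : WorldP} {θ : Stage12Params F N} (hk : IsRateKey₁₂ F N D w θ) {c ρ : ℝ} (hρ1 : ρ < 1)
    (hlim : letI := θ.instVβ₁; letI := θ.instVβ₂; letI := θ.instιβ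
      Beta0LimitExists (betaMerged F (mergedTermFamilyMatT F N (TcOfRecord F N) (chiFixed7 F N θ.ν) θ.εbg) θ.ρ8 θ.bV) θ.v₀)
    (hcoh : ∀ k, Fin.tail (θ.v₀ (k + 1)) = θ.v₀ k) (hadm : ∀ k i, 0 < θ.v₀ k i ∧ θ.v₀ k i ≤ w.γ) (hN17 : NE4OnData D c ρ w.γ) :
    letI := θ.instVβ₁; letI := θ.instVβ₂; letI := θ.instιβ
    ∃ binf : ℝ, ∀ k,
      |beta0OfMerged (betaMerged F (mergedTermFamilyMatT F N (TcOfRecord F N) (chiFixed7 F N θ.ν) θ.εbg) θ.ρ8 θ.bV) θ.v₀ k - binf| ≤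
        c / (1 - ρ) * ρ ^ k := by
  letI := θ.instVβ₁; letI := θ.instVβ₂; letI := θ.instιβ
  exact af0r_beta0OfMerged_of_scaleShiftRate hlim hcoh hadm hk.gamma_pos hρ1 ((N17_iff_of_isRateKey₁₂ hk c ρ).mp hN17)

/-! ## §51 N17 AT THE LEVEL BUNDLES OF RR-1's `U3Objects₁₁` AT THE STAGE-12 KEY, AND THE HOME SHAPES OVER A READING TAKING THE PROVISOS -/

/-- **N17 AT THE LEVEL-`k` BUNDLE OF THE RECORD's U3 OBJECTS, AT A STAGE-12 DATUM OF RECORD, window inside the canonical record box (`γ ≤ h.params.γ`; layer B takes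
`γ := h.params.γ`)**: ⟺ the `βmT(h.params)` rate `ScaleShiftRate (u.cr·u.C₅·u.θ₅) u.ρ γ` — level-free and carrier-free (companion 11's stage-free
`n17At_u3Level₁₁_iff`, `Iff.rfl`: N17 never reads `levelCarriers ∕ EA ∕ EB`). [cite: Balaban1987RG1, (1.20)-(1.22) p.264] -/
theorem n17At_u3Level_iff_params₁₂ {D : Datum F N} (h : IsDatumOfRecord₁₂C F N D) (u : U3Objects₁₁) {γ : ℝ} (hγ : γ ≤ h.params.γ) (k : ℕ) :
    N17At D ⟨u.levelCarriers k, Window γ, γ, u.κ, u.EA k, u.EB k, u.θ₅, u.C₅, u.moduli, u.C₉, u.ω, u.cr, u.ρ⟩ ↔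
      letI := h.params.instVβ₁; letI := h.params.instVβ₂; letI := h.params.instιβ
      ScaleShiftRate (u.cr * u.C₅ * u.θ₅) u.ρ γ
        (betaMerged F (mergedTermFamilyMatT F N (TcOfRecord F N) (chiFixed7 F N h.params.ν) h.params.εbg) h.params.ρ8 h.params.bV) :=
  N17_iff_merged_params₁₂ h hγ

section HomeShapes

variable (rc : (F : T4Family) → (θ : Stage12Params F N) → θ.Provisos₁₂ F N → (ℕ → ℝ) → List (ULoop F) → ℕ → RateCarriers N)

/-- **`S_N17` AT A TOWER-KEYED RATE RECORD OF LAYER B's LITERAL STAGE-12 SHAPE** «`RRec F D g₀ os R :↔ ∃ (h : IsDatumOfRecord₁₂C F N D) (k : ℕ), R = rc F h.params h.provisos g₀ os k`»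
(n22-e's `RRec₁₂ 𝔯` is this with `rc := rateCarriersOfRecord₁₂ 𝔯`; the reading TAKES THE PROVISOS) ⟺ «at every Stage-12 datum of record, every `g₀, os`, every run length `k`:
the scale-shift rate of `betaOfRecord₁₀ h.params.toStage9Params` at the reading's U3 letters» — every box side, no window hypothesis; `rc` a PARAMETER.
[cite: Balaban1987RG1, (1.20)-(1.22) p.264] -/
theorem s_N17_towerKeyed₁₂_iff :
    S_N17 (fun F (D : Datum F N) g₀ os R => ∃ (h : IsDatumOfRecord₁₂C F N D) (k : ℕ), R = rc F h.params h.provisos g₀ os k) ↔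
      ∀ (F : T4Family) (D : Datum F N) (h : IsDatumOfRecord₁₂C F N D) (g₀ : ℕ → ℝ) (os : List (ULoop F)) (k : ℕ),
        ScaleShiftRate
          ((rc F h.params h.provisos g₀ os k).u3.cr * (rc F h.params h.provisos g₀ os k).u3.C₅ * (rc F h.params h.provisos g₀ os k).u3.θ)
          (rc F h.params h.provisos g₀ os k).u3.ρ (rc F h.params h.provisos g₀ os k).u3.γ (betaOfRecord₁₀ F N h.params.toStage9Params) := by
  constructor
  · intro hS F D h g₀ os k
    exact (n17At_iff_betaOfRecord₁₀_params₁₂ h _).mp (hS F D g₀ os _ ⟨h, k, rfl⟩)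
  · rintro hin F D g₀ os R ⟨h, k, rfl⟩
    exact (n17At_iff_betaOfRecord₁₀_params₁₂ h _).mpr (hin F D h g₀ os k)

/-- **… FROM THE MERGED-β RATE** when the reading's window sits inside the canonical record box (`(rc …).u3.γ ≤ h.params.γ`, e.g. layer B's `u3.γ = θ.γ`): the
`βmT(h.params)` rate at the letters, for every datum key, `g₀, os, k` ⟹ `S_N17` there. [cite: Balaban1987RG1, (1.20)-(1.22) p.264] -/
theorem s_N17_towerKeyed₁₂_of_merged
    (hin : ∀ (F : T4Family) (D : Datum F N) (h : IsDatumOfRecord₁₂C F N D) (g₀ : ℕ → ℝ) (os : List (ULoop F)) (k : ℕ),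
      (rc F h.params h.provisos g₀ os k).u3.γ ≤ h.params.γ ∧
        letI := h.params.instVβ₁; letI := h.params.instVβ₂; letI := h.params.instιβ
        ScaleShiftRate
          ((rc F h.params h.provisos g₀ os k).u3.cr * (rc F h.params h.provisos g₀ os k).u3.C₅ * (rc F h.params h.provisos g₀ os k).u3.θ)
          (rc F h.params h.provisos g₀ os k).u3.ρ (rc F h.params h.provisos g₀ os k).u3.γ
          (betaMerged F (mergedTermFamilyMatT F N (TcOfRecord F N) (chiFixed7 F N h.params.ν) h.params.εbg) h.params.ρ8 h.params.bV)) :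
    S_N17 (fun F (D : Datum F N) g₀ os R => ∃ (h : IsDatumOfRecord₁₂C F N D) (k : ℕ), R = rc F h.params h.provisos g₀ os k) := by
  rintro F D g₀ os R ⟨h, k, rfl⟩
  obtain ⟨hγ, hm⟩ := hin F D h g₀ os k
  exact (n17At_iff_params₁₂ h _ hγ).mpr hm

end HomeShapes

/-- **(W2) CLOSER FOR ANY `RRec` WHOSE BUNDLES COME WITH A STAGE-12 DATUM KEY** (refinement-generic): if every bundle `R` of record for `(F, D, g₀, os)` comes with
`h : IsDatumOfRecord₁₂C F N D`, `R.u3.γ ≤ h.params.γ` and the `βmT(h.params)` rate at `R.u3`'s letters, then `S_N17 RRec` — ONE application at layer B (`RRec₁₂.datumKey` + the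
estimate). [cite: Balaban1987RG1, (1.20)-(1.22) p.264] -/
theorem s_N17_of_datumKeyed₁₂ (RRec : RateRecordPred N)
    (hkey : ∀ (F : T4Family) (D : Datum F N) (g₀ : ℕ → ℝ) (os : List (ULoop F)) (R : RateCarriers N), RRec F D g₀ os R →
      ∃ h : IsDatumOfRecord₁₂C F N D, R.u3.γ ≤ h.params.γ ∧
        letI := h.params.instVβ₁; letI := h.params.instVβ₂; letI := h.params.instιβ
        ScaleShiftRate (R.u3.cr * R.u3.C₅ * R.u3.θ) R.u3.ρ R.u3.γ
          (betaMerged F (mergedTermFamilyMatT F N (TcOfRecord F N) (chiFixed7 F N h.params.ν) h.params.εbg) h.params.ρ8 h.params.bV)) :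
    S_N17 RRec := by
  intro F D g₀ os R hR
  obtain ⟨h, hγ, hm⟩ := hkey F D g₀ os R hR
  exact (n17At_iff_params₁₂ h R.u3 hγ).mpr hm

/-- **(W2) CLOSER FOR ANY `RRec` WHOSE BUNDLES COME WITH A θ-EXPOSED STAGE-12 KEY** whose world window IS node U3's box (`R.u3.γ = w.γ`) and the `βmT(θ)` rate at
`R.u3`'s letters ⟹ `S_N17 RRec` (RR-2 §3's world-bound road; companion 13 `s_N17_of_rec₁₂C` without the ∀ θ). [cite: Balaban1987RG1, (1.20)-(1.22) p.264] -/
theorem s_N17_of_rateKeyed₁₂ (RRec : RateRecordPred N)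
    (hkey : ∀ (F : T4Family) (D : Datum F N) (g₀ : ℕ → ℝ) (os : List (ULoop F)) (R : RateCarriers N), RRec F D g₀ os R →
      ∃ (θ : Stage12Params F N) (w : WorldP), IsRateKey₁₂ F N D w θ ∧ R.u3.γ = w.γ ∧
        letI := θ.instVβ₁; letI := θ.instVβ₂; letI := θ.instιβ
        ScaleShiftRate (R.u3.cr * R.u3.C₅ * R.u3.θ) R.u3.ρ R.u3.γ
          (betaMerged F (mergedTermFamilyMatT F N (TcOfRecord F N) (chiFixed7 F N θ.ν) θ.εbg) θ.ρ8 θ.bV)) :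
    S_N17 RRec := by
  intro F D g₀ os R hR
  obtain ⟨θ, w, hk, hγ, hm⟩ := hkey F D g₀ os R hR
  exact (n17At_iff_of_isRateKey₁₂ hk R.u3 (hγ.le.trans hk.gamma_le)).mpr hm

/-! ## §52 THE KEYED U3 GLUE «(D4) ∧ NE5 ⇒ NE4» AT THE STAGE-12 TUPLES, GUARD-GENERIC (N22 idle: `YMDAG.N17.n17At_of_readOutAt`) -/

section KeyedGlue

variable (P : (F : T4Family) → (θ : Stage12Params F N) → θ.Provisos₁₂ F N → Prop)
variable (rr : (F : T4Family) → (θ : Stage12Params F N) → θ.Provisos₁₂ F N → (ℕ → ℝ) → List (ULoop F) → RateCarriers N)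

/-- **n27-c XXIV∕XXV's `h17` FROM THE KEYED (D4) AND NE5 STUBS, Stage 12, FOR ANY GUARD `P` ON THE TUPLE** (`P F θ hP := θ.Admissible F N` for the plain ₁₂C class;
`P F θ hP := θ.ZtUnity F N ∧ θ.Admissible F N` — or any prefix implying it — for print's partition-of-unity class of director-ym LINE №99 (2); the glue never reads
`P`): for a rate reading `rr` off the Stage-12 tuples, the (D4) read-out binders at `(datumOfRecord₁₂ θ hP, (rr F θ hP g₀ os).u3)` and NE5 at `(rr F θ hP g₀ os).u3`
under the guard ⟹ the keyed N17 stub `∀ F θ hP, P F θ hP → ∀ g₀ os, N17At (datumOfRecord₁₂ F N θ hP) (rr F θ hP g₀ os).u3` — pointwise `YMDAG.N17.n17At_of_readOutAt`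
(the U3 → U2 edge, N22 idle).  (D4) and NE5 UNPRINTED — binders. [cite: Balaban1987RG1, (1.20)-(1.22) p.264] -/
theorem n17_keyed₁₂_of_readOut_keyed
    (hD4 : ∀ (F : T4Family) (θ : Stage12Params F N) (hP : θ.Provisos₁₂ F N), P F θ hP → ∀ (g₀ : ℕ → ℝ) (os : List (ULoop F)),
      ReadOutAt (datumOfRecord₁₂ F N θ hP) (rr F θ hP g₀ os).u3)
    (h18 : ∀ (F : T4Family) (θ : Stage12Params F N) (hP : θ.Provisos₁₂ F N), P F θ hP → ∀ (g₀ : ℕ → ℝ) (os : List (ULoop F)),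
      N18At (rr F θ hP g₀ os).u3)
    (F : T4Family) (θ : Stage12Params F N) (hP : θ.Provisos₁₂ F N) (hθ : P F θ hP) (g₀ : ℕ → ℝ) (os : List (ULoop F)) :
    N17At (datumOfRecord₁₂ F N θ hP) (rr F θ hP g₀ os).u3 :=
  YMDAG.N17.n17At_of_readOutAt _ (hD4 F θ hP hθ g₀ os) (h18 F θ hP hθ g₀ os)

/-- **XXIV∕XXV's `hrates` FROM THE FIVE KEYED RATE STUBS AND THE KEYED (D4), Stage 12, any guard `P`** (N17 GLUED, not assumed): N14 NE1′ · N15 NE2 · N16 NE3 · N18 NE5 ·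
N22 NE9 at `rr F θ hP g₀ os` and the (D4) read-out on the datum of record, under the guard ⟹ `RatesAt (datumOfRecord₁₂ θ hP) (rr F θ hP g₀ os)` under the same guard
(n27-c XXV `keyedUnity₁₂_of_keyedFaces`'s rates face at `P := unity ∧ admissible`). [bookkeeping] [cite: Balaban1987RG1, (1.20)-(1.22) p.264] -/
theorem ratesAt_keyed₁₂_of_five_glueN17
    (h14 : ∀ (F : T4Family) (θ : Stage12Params F N) (hP : θ.Provisos₁₂ F N), P F θ hP → ∀ (g₀ : ℕ → ℝ) (os : List (ULoop F)),
      N14At (rr F θ hP g₀ os).ne1)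
    (h15 : ∀ (F : T4Family) (θ : Stage12Params F N) (hP : θ.Provisos₁₂ F N), P F θ hP → ∀ (g₀ : ℕ → ℝ) (os : List (ULoop F)),
      N15At (rr F θ hP g₀ os).ne2)
    (h16 : ∀ (F : T4Family) (θ : Stage12Params F N) (hP : θ.Provisos₁₂ F N), P F θ hP → ∀ (g₀ : ℕ → ℝ) (os : List (ULoop F)),
      N16At (rr F θ hP g₀ os).ne3)
    (h18 : ∀ (F : T4Family) (θ : Stage12Params F N) (hP : θ.Provisos₁₂ F N), P F θ hP → ∀ (g₀ : ℕ → ℝ) (os : List (ULoop F)),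
      N18At (rr F θ hP g₀ os).u3)
    (h22 : ∀ (F : T4Family) (θ : Stage12Params F N) (hP : θ.Provisos₁₂ F N), P F θ hP → ∀ (g₀ : ℕ → ℝ) (os : List (ULoop F)),
      N22At (rr F θ hP g₀ os).u3)
    (hD4 : ∀ (F : T4Family) (θ : Stage12Params F N) (hP : θ.Provisos₁₂ F N), P F θ hP → ∀ (g₀ : ℕ → ℝ) (os : List (ULoop F)),
      ReadOutAt (datumOfRecord₁₂ F N θ hP) (rr F θ hP g₀ os).u3)
    (F : T4Family) (θ : Stage12Params F N) (hP : θ.Provisos₁₂ F N) (hθ : P F θ hP) (g₀ : ℕ → ℝ) (os : List (ULoop F)) :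
    RatesAt (datumOfRecord₁₂ F N θ hP) (rr F θ hP g₀ os) :=
  ⟨h14 F θ hP hθ g₀ os, h15 F θ hP hθ g₀ os, h16 F θ hP hθ g₀ os, n17_keyed₁₂_of_readOut_keyed P rr hD4 h18 F θ hP hθ g₀ os,
    h18 F θ hP hθ g₀ os, h22 F θ hP hθ g₀ os⟩

end KeyedGlue

/-- **THE SAME GLUE AT LAYER B's STAGE-12 TOWER KEY**: for a reading `rc` off `(h.params, h.provisos, g₀, os, k)` (layer B's `rateCarriersOfRecord₁₂ 𝔯`), the (D4)
read-out and NE5 at the bundles of record of every Stage-12 datum of record ⟹ N17 there (pointwise `YMDAG.N17.n17At_of_readOutAt`); at the home this is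
`S_D4 (RRec₁₂ 𝔯) → S_N18 (RRec₁₂ 𝔯) → S_N17 (RRec₁₂ 𝔯)` = `YMDAG.N17.s_N17_of_D4_N18` verbatim (not restated). [cite: Balaban1987RG1, (1.20)-(1.22) p.264] -/
theorem n17_towerKeyed₁₂_of_readOut
    (rc : (F : T4Family) → (θ : Stage12Params F N) → θ.Provisos₁₂ F N → (ℕ → ℝ) → List (ULoop F) → ℕ → RateCarriers N)
    (hD4 : ∀ (F : T4Family) (D : Datum F N) (h : IsDatumOfRecord₁₂C F N D) (g₀ : ℕ → ℝ) (os : List (ULoop F)) (k : ℕ),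
      ReadOutAt D (rc F h.params h.provisos g₀ os k).u3)
    (h18 : ∀ (F : T4Family) (D : Datum F N) (h : IsDatumOfRecord₁₂C F N D) (g₀ : ℕ → ℝ) (os : List (ULoop F)) (k : ℕ),
      N18At (rc F h.params h.provisos g₀ os k).u3)
    (F : T4Family) (D : Datum F N) (h : IsDatumOfRecord₁₂C F N D) (g₀ : ℕ → ℝ) (os : List (ULoop F)) (k : ℕ) :
    N17At D (rc F h.params h.provisos g₀ os k).u3 :=
  YMDAG.N17.n17At_of_readOutAt _ (hD4 F D h g₀ os k) (h18 F D h g₀ os k)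

end Summit.QuantumFields.YangMills.Theorems.BalabanUVNodesN17

end
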